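import Literature.Topology.FourManifolds.TautFoliationsSlabs
import Literature.Topology.FourManifolds.TautFoliationsClosedLeaves
import HarnessLib

/-!
# The side of a region bounded by a closed leaf is well defined and constant along the leaf

Sibling of `TautFoliationsSlabs.lean` (slabs of a flow box, their two sides, and
`sides_cases`: next to the leaf `L = frontier R` of a region `R = closure (interior R)`,
exactly one side of a thin slab lies in `interior R`) and `TautFoliationsClosedLeaves.lean`
(thin slabs exist around every point of a closed leaf). For a `C⁰` codimension-one foliation
`F : Literature.Topology.FourManifolds.Foliation B M` of a second countable space with preconnected nonempty leaf model
this file proves, with complete proofs (Novikov, *Topology of foliations* (1965), §5, the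
"positive/negative side" of a compact leaf bounding a component; Hector–Hirsch, *Part A*,
Ch. II 2.2.8: transverse orientation):

* `Foliation.LiesAbove R e y` / `Foliation.LiesBelow R e y` (**definitions**): `interior R`
  contains a thin upper (lower) slab of the box `e` over (under) the plaque of `y`.
* `liesAbove_or_liesBelow`, `not_liesAbove_and_liesBelow` (**proved**): for `y ∈ L` these are
  exhaustive and mutually exclusive; `LiesAbove.sides` / `LiesBelow.sides`: the other side of
  every thin slab then lies in `Rᶜ`.
* `LiesAbove.of_chart`, `LiesBelow.of_chart` (**proved**): **the side does not depend on the
  flow box for a transversely oriented atlas** — the vertical segment of `e` above `y` enters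
  every other box `e' ∋ y` on its upper side (the change of coordinates is increasing in the
  transverse coordinate) and lies in `interior R`.
* `LiesAbove.of_mem_leaf`, `LiesBelow.of_mem_leaf` (**proved**): **the side on which `R` lies
  is constant along the leaf** — if `R` lies above `L` at one point of `L` in one flow box, it
  lies above `L` at every point of `L` in every flow box (transport along chains of plaques:
  within one box the side depends only on the height of the plaque).

These feed `TautFoliationsDeadEnds.lean`: a positive closed transversal crossing `L` enters
`interior R` at every crossing (or leaves it at every crossing), which is impossible for a
periodic curve — so no closed transversal meets `L`, and `F` is not taut.

## References

* S. P. Novikov, *The topology of foliations*, Trudy Moskov. Mat. Obšč. 14 (1965) 248–278, §5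
  [Novikov1965].
* J. Schultens, *Introduction to 3-Manifolds*, Grad. Stud. Math. 151, AMS (2014), Lemma 7.5.14
  [Schultens2014].
* G. Hector, U. Hirsch, *Introduction to the Geometry of Foliations, Part A* (1986), Ch. II
  2.2.8 [HectorHirsch1986].

## Design notes

* As in `TautFoliationsSlabs.lean`, `R` is only assumed to satisfy `closure (interior R) = R`
  and `frontier R = F.leaf x`; the leaf is then closed (a frontier), so thin slabs exist by
  `exists_mem_leaf_iff_of_isClosed` (this is where second countability of `M` enters).
-/

open scoped Topology
open Function Set Filter

namespace Literature.Topology.FourManifolds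

namespace Foliation

variable {B : Type*} [TopologicalSpace B] {M : Type*} [TopologicalSpace M]
variable {e e' : OpenPartialHomeomorph M (B × ℝ)} {t δ : ℝ} {x y z : M} {R : Set M}

/-! ## The side of the region, as a property of a point of the leaf -/

/-- **`R` lies above `y` in the flow box `e`**: some upper slab of `e` over the plaque of `y`
is contained in `interior R`. [folklore] -/
def LiesAbove (R : Set M) (e : OpenPartialHomeomorph M (B × ℝ)) (y : M) : Prop :=
  ∃ δ > (0 : ℝ), upperSlab e (e y).2 δ ⊆ interior R

/-- **`R` lies below `y` in the flow box `e`**: some lower slab of `e` under the plaque of `y`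
is contained in `interior R`. [folklore] -/
def LiesBelow (R : Set M) (e : OpenPartialHomeomorph M (B × ℝ)) (y : M) : Prop :=
  ∃ δ > (0 : ℝ), lowerSlab e (e y).2 δ ⊆ interior R

variable {F : Foliation B M}

/-- Within one flow box the side depends only on the plaque: points of the plaque of `y` see
`R` above them iff `y` does. [folklore] -/
theorem liesAbove_iff_of_mem_plaque (hy' : z ∈ plaque e (e y).2) :
    LiesAbove R e z ↔ LiesAbove R e y := by
  simp only [LiesAbove, hy'.2]

/-- Within one flow box the side depends only on the plaque (lower version). [folklore] -/
theorem liesBelow_iff_of_mem_plaque (hy' : z ∈ plaque e (e y).2) :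
    LiesBelow R e z ↔ LiesBelow R e y := by
  simp only [LiesBelow, hy'.2]

section Closed

variable [SecondCountableTopology M] [PreconnectedSpace B] [Nonempty B]

/-- Next to the leaf `frontier R`, the region lies above or below each of its points, in each
flow box (`sides_cases` for a thin slab given by `exists_mem_leaf_iff_of_isClosed`).
[folklore] -/
theorem liesAbove_or_liesBelow (he : e ∈ F.atlas) (hreg : closure (interior R) = R)
    (hT : frontier R = F.leaf x) (hy : y ∈ F.leaf x) (hye : y ∈ e.source) :
    LiesAbove R e y ∨ LiesBelow R e y := by
  have hL : IsClosed (F.leaf x) := hT ▸ isClosed_frontier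
  obtain ⟨δ, hδ0, hδ⟩ := F.exists_mem_leaf_iff_of_isClosed hL he hy hye
  rcases sides_cases he hreg hT hy hye hδ0 hδ with ⟨hu, -⟩ | ⟨-, hl⟩
  · exact Or.inl ⟨δ, hδ0, hu⟩
  · exact Or.inr ⟨δ, hδ0, hl⟩

/-- The region does not lie on both sides of a point of the leaf `frontier R`. [folklore] -/
theorem not_liesAbove_and_liesBelow (he : e ∈ F.atlas) (hreg : closure (interior R) = R)
    (hT : frontier R = F.leaf x) (hy : y ∈ F.leaf x) (hye : y ∈ e.source) :
    ¬ (LiesAbove R e y ∧ LiesBelow R e y) := by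
  rintro ⟨⟨δ₁, hδ₁, h₁⟩, ⟨δ₂, hδ₂, h₂⟩⟩
  have hL : IsClosed (F.leaf x) := hT ▸ isClosed_frontier
  obtain ⟨δ₀, hδ₀, hδ⟩ := F.exists_mem_leaf_iff_of_isClosed hL he hy hye
  set δ := min δ₀ (min δ₁ δ₂) with hδdef
  have hδpos : 0 < δ := lt_min hδ₀ (lt_min hδ₁ hδ₂)
  have hδ' : ∀ z ∈ e.source, |(e z).2 - (e y).2| < δ → (z ∈ F.leaf x ↔ (e z).2 = (e y).2) :=
    fun z hz hzδ ↦ hδ z hz (hzδ.trans_le (min_le_left _ _))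
  have hu : upperSlab e (e y).2 δ ⊆ interior R :=
    (upperSlab_mono ((min_le_right _ _).trans (min_le_left _ _))).trans h₁
  have hl : lowerSlab e (e y).2 δ ⊆ interior R :=
    (lowerSlab_mono ((min_le_right _ _).trans (min_le_right _ _))).trans h₂
  rcases sides_cases he hreg hT hy hye hδpos hδ' with ⟨-, hl'⟩ | ⟨hu', -⟩
  · obtain ⟨b⟩ := ‹Nonempty B›
    have hm : e.symm (b, (e y).2 - δ / 2) ∈ lowerSlab e (e y).2 δ := by
      rw [F.lowerSlab_eq_image he]
      exact ⟨(b, (e y).2 - δ / 2), ⟨mem_univ _, by linarith, by linarith⟩, rfl⟩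
    exact hl' hm (interior_subset (hl hm))
  · obtain ⟨b⟩ := ‹Nonempty B›
    have hm : e.symm (b, (e y).2 + δ / 2) ∈ upperSlab e (e y).2 δ :=
      F.symm_mem_upperSlab he b (by linarith) (by linarith)
    exact hu' hm (interior_subset (hu hm))

/-- **If the region lies above `y`, every thin slab has its upper side inside and its lower
side outside** (for a thickness `δ` at which the slab meets the leaf in one plaque).
[folklore] -/
theorem LiesAbove.sides (h : LiesAbove R e y) (he : e ∈ F.atlas)
    (hreg : closure (interior R) = R) (hT : frontier R = F.leaf x) (hy : y ∈ F.leaf x)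
    (hye : y ∈ e.source) (hδ0 : 0 < δ)
    (hδ : ∀ z ∈ e.source, |(e z).2 - (e y).2| < δ → (z ∈ F.leaf x ↔ (e z).2 = (e y).2)) :
    upperSlab e (e y).2 δ ⊆ interior R ∧ lowerSlab e (e y).2 δ ⊆ Rᶜ := by
  rcases sides_cases he hreg hT hy hye hδ0 hδ with h' | ⟨hu, hl⟩
  · exact h'
  · exact absurd ⟨h, δ, hδ0, hl⟩ (not_liesAbove_and_liesBelow he hreg hT hy hye)

/-- **If the region lies below `y`, every thin slab has its lower side inside and its upper
side outside.** [folklore] -/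
theorem LiesBelow.sides (h : LiesBelow R e y) (he : e ∈ F.atlas)
    (hreg : closure (interior R) = R) (hT : frontier R = F.leaf x) (hy : y ∈ F.leaf x)
    (hye : y ∈ e.source) (hδ0 : 0 < δ)
    (hδ : ∀ z ∈ e.source, |(e z).2 - (e y).2| < δ → (z ∈ F.leaf x ↔ (e z).2 = (e y).2)) :
    upperSlab e (e y).2 δ ⊆ Rᶜ ∧ lowerSlab e (e y).2 δ ⊆ interior R := by
  rcases sides_cases he hreg hT hy hye hδ0 hδ with ⟨hu, hl⟩ | h'
  · exact absurd ⟨⟨δ, hδ0, hu⟩, h⟩ (not_liesAbove_and_liesBelow he hreg hT hy hye)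
  · exact h'

/-- **The side does not depend on the flow box** (transversely oriented atlas): if `R` lies
above `y ∈ L` in the box `e`, it lies above `y` in every box `e' ∋ y` of the atlas. The points
`e.symm (b, h(y) + τ)`, `τ → 0⁺`, of the vertical of `e` above `y` lie in `interior R` and, by
the transverse orientation, on the upper side of `e'` at `y`; that side, being inside or
outside as a whole, is inside. [folklore] -/
theorem LiesAbove.of_chart (ho : F.IsTransverselyOriented) (h : LiesAbove R e y) (he : e ∈ F.atlas)
    (he' : e' ∈ F.atlas) (hreg : closure (interior R) = R) (hT : frontier R = F.leaf x)
    (hy : y ∈ F.leaf x) (hye : y ∈ e.source) (hye' : y ∈ e'.source) : LiesAbove R e' y := by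
  obtain ⟨δ₁, hδ₁, h₁⟩ := h
  have hL : IsClosed (F.leaf x) := hT ▸ isClosed_frontier
  obtain ⟨δ', hδ'0, hδ'⟩ := F.exists_mem_leaf_iff_of_isClosed hL he' hy hye'
  -- the vertical of `e` above `y`
  set φ : ℝ → M := fun τ ↦ e.symm ((e y).1, (e y).2 + τ) with hφ
  have hφc : Continuous φ := (F.continuous_symm_of_mem he).comp
    (continuous_const.prodMk (continuous_const.add continuous_id))
  have hφ0 : φ 0 = y := by
    simp only [hφ, add_zero, Prod.mk.eta]
    exact e.left_inv hye
  -- transverse orientation for the pair `(e, e')` near `y`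
  obtain ⟨U, hU, hUo⟩ := ho e he e' he' y ⟨hye, hye'⟩
  have h₁' : ∀ᶠ τ in 𝓝 (0 : ℝ), φ τ ∈ U ∩ e'.source :=
    hφc.continuousAt.preimage_mem_nhds
      (by rw [hφ0]; exact inter_mem hU (e'.open_source.mem_nhds hye'))
  have h₂' : ∀ᶠ τ in 𝓝 (0 : ℝ), (e' (φ τ)).2 < (e' y).2 + δ' := by
    have hca : ContinuousAt (fun τ ↦ (e' (φ τ)).2) 0 :=
      (continuous_snd.continuousAt.comp (e'.continuousAt (by rwa [hφ0]))).comp hφc.continuousAt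
    have : (fun τ ↦ (e' (φ τ)).2) 0 < (e' y).2 + δ' := by
      simp only [hφ0]
      linarith
    exact hca.eventually (eventually_lt_nhds this)
  have h₃' : ∀ᶠ τ in 𝓝 (0 : ℝ), τ < δ₁ := eventually_lt_nhds hδ₁
  obtain ⟨τ, ⟨⟨⟨hτU, hτe'⟩, hτδ'⟩, hτδ₁⟩, hτ0⟩ :=
    (((h₁'.and h₂').and h₃').filter_mono nhdsWithin_le_nhds).and self_mem_nhdsWithin
      |>.exists (f := 𝓝[>] (0 : ℝ))
  -- the point `φ τ` is inside `R` and on the upper side of `e'` at `y`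
  have hτup : φ τ ∈ upperSlab e (e y).2 δ₁ := F.symm_mem_upperSlab he (e y).1 hτ0 hτδ₁
  have hτR : φ τ ∈ interior R := h₁ hτup
  have hlt : (e' y).2 < (e' (φ τ)).2 :=
    hUo y ⟨mem_of_mem_nhds hU, hye, hye'⟩ (φ τ) ⟨hτU, hτup.1, hτe'⟩ hτup.2.1
  have hτup' : φ τ ∈ upperSlab e' (e' y).2 δ' := ⟨hτe', hlt, hτδ'⟩
  rcases sides_cases he' hreg hT hy hye' hδ'0 hδ' with ⟨hu', -⟩ | ⟨hu', -⟩
  · exact ⟨δ', hδ'0, hu'⟩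
  · exact absurd (interior_subset hτR) (hu' hτup')

/-- **The side does not depend on the flow box** (lower version; from the upper version by
exhaustion and exclusivity of the two sides). [folklore] -/
theorem LiesBelow.of_chart (ho : F.IsTransverselyOriented) (h : LiesBelow R e y) (he : e ∈ F.atlas)
    (he' : e' ∈ F.atlas) (hreg : closure (interior R) = R) (hT : frontier R = F.leaf x)
    (hy : y ∈ F.leaf x) (hye : y ∈ e.source) (hye' : y ∈ e'.source) : LiesBelow R e' y := by
  rcases liesAbove_or_liesBelow he' hreg hT hy hye' with h' | h'
  · exact absurd ⟨h'.of_chart ho he' he hreg hT hy hye' hye, h⟩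
      (not_liesAbove_and_liesBelow he hreg hT hy hye)
  · exact h'

/-- **The side on which the region lies is constant along the leaf.** If `R` (the closure of
its interior, with frontier the leaf `L = F.leaf x`) lies above the point `y₁ ∈ L` in a flow
box `e₁ ∋ y₁` of a transversely oriented atlas, then it lies above every point `y₂ ∈ L` in every
flow box `e₂ ∋ y₂` of the atlas: along a chain of plaques from `y₁` to `y₂`, the side is
constant on each plaque (it depends only on the height) and independent of the box at each
point (`LiesAbove.of_chart`). [folklore] -/
theorem LiesAbove.of_mem_leaf (ho : F.IsTransverselyOriented) {e₁ e₂ : OpenPartialHomeomorph M (B × ℝ)}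
    {y₁ y₂ : M} (h : LiesAbove R e₁ y₁) (he₁ : e₁ ∈ F.atlas) (he₂ : e₂ ∈ F.atlas)
    (hreg : closure (interior R) = R) (hT : frontier R = F.leaf x) (hy₁ : y₁ ∈ F.leaf x)
    (hy₂ : y₂ ∈ F.leaf x) (h₁ : y₁ ∈ e₁.source) (h₂ : y₂ ∈ e₂.source) : LiesAbove R e₂ y₂ := by
  -- `P a`: `a ∈ L` and `R` lies above `a` in every box around `a`
  let P : M → Prop := fun a ↦ a ∈ F.leaf x ∧ ∀ e ∈ F.atlas, a ∈ e.source → LiesAbove R e a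
  have hPP : ∀ {a b : M}, Relation.EqvGen F.SamePlaque a b → (P a ↔ P b) := by
    intro a b hab
    induction hab with
    | rel a b hab =>
      obtain ⟨e, he, hae, hbe, habe⟩ := hab
      have hab' : b ∈ F.leaf a := (show F.SamePlaque a b from ⟨e, he, hae, hbe, habe⟩).mem_leaf
      constructor
      · rintro ⟨haL, ha⟩
        have hbL : b ∈ F.leaf x := by
          rw [← leaf_eq_of_mem haL]
          exact hab'
        refine ⟨hbL, fun e' he' hbe' ↦ ?_⟩
        have hb : LiesAbove R e b :=
          (liesAbove_iff_of_mem_plaque (R := R) ⟨hbe, habe.symm⟩).2 (ha e he hae)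
        exact hb.of_chart ho he he' hreg hT hbL hbe hbe'
      · rintro ⟨hbL, hb⟩
        have haL : a ∈ F.leaf x := by
          rw [← leaf_eq_of_mem hbL]
          exact mem_leaf_comm.1 hab'
        refine ⟨haL, fun e' he' hae' ↦ ?_⟩
        have ha : LiesAbove R e a :=
          (liesAbove_iff_of_mem_plaque (R := R) ⟨hae, habe⟩).2 (hb e he hbe)
        exact ha.of_chart ho he he' hreg hT haL hae hae'
    | refl a => exact Iff.rfl
    | symm a b _ ih => exact ih.symm
    | trans a b c _ _ ih₁ ih₂ => exact ih₁.trans ih₂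
  have h12 : Relation.EqvGen F.SamePlaque y₁ y₂ :=
    Relation.EqvGen.trans _ _ _ (Relation.EqvGen.symm _ _ hy₁) hy₂
  have hP₁ : P y₁ := ⟨hy₁, fun e he hye ↦ h.of_chart ho he₁ he hreg hT hy₁ h₁ hye⟩
  exact ((hPP h12).1 hP₁).2 e₂ he₂ h₂

/-- **The side on which the region lies is constant along the leaf** (lower version).
[folklore] -/
theorem LiesBelow.of_mem_leaf (ho : F.IsTransverselyOriented) {e₁ e₂ : OpenPartialHomeomorph M (B × ℝ)}
    {y₁ y₂ : M} (h : LiesBelow R e₁ y₁) (he₁ : e₁ ∈ F.atlas) (he₂ : e₂ ∈ F.atlas)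
    (hreg : closure (interior R) = R) (hT : frontier R = F.leaf x) (hy₁ : y₁ ∈ F.leaf x)
    (hy₂ : y₂ ∈ F.leaf x) (h₁ : y₁ ∈ e₁.source) (h₂ : y₂ ∈ e₂.source) : LiesBelow R e₂ y₂ := by
  rcases liesAbove_or_liesBelow he₂ hreg hT hy₂ h₂ with h' | h'
  · exact absurd ⟨h'.of_mem_leaf ho he₂ he₁ hreg hT hy₂ hy₁ h₂ h₁, h⟩
      (not_liesAbove_and_liesBelow he₁ hreg hT hy₁ h₁)
  · exact h'

end Closed

end Foliation

end Literature.Topology.FourManifolds
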